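import Summits.QuantumFields.BalabanUV.T4Continuum.Support.NE7DiagonalGaugeCurve
import Summits.QuantumFields.BalabanUV.T4Continuum.Support.NE7MinActC2AllDataUniform
import HarnessLib

/-!
# NE7BorderedHessianGaugeDegenerate — THE BORDERED HESSIAN OF THE CONSTRAINED MINIMAL ACTION IS DEGENERATE ALONG THE FINE STABILISER ORBIT: for every corner-trivial fine gauge
# parameter `Y`, with `ξ_Y = gaugeDir_{U♯} Y` (a direction in `ker levelQ′`), `B[X + ξ_Y, X + ξ_Y] = B[X, X]` for EVERY fine direction `X`, where
# `B[X,X] = w·D²𝒜(0)[X,X] − Dm(0)[D²𝒢(0)[X,X]]` is the quantity minimised in ✓ p828683 (ROAD-G116 §4 (a)(iii) ∕ §6 (G3): «B[ξ_Y, ·] = 0 on the orbit tangent since U♯ is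
# Lagrangian-critical» — so the (G) assembly may restrict the lifts `X` to any linear gauge slice through `ker levelQ′`'s stabiliser part)

Cell `pub-balaban`, rung (B)+1 sub-cell t4, lineage `b2b-balaban-t4-ne7b-p1` (row NE7b OWNER + CRUX PROVER; junction service for row NE7, ruling R-OWNER-149-1 (2)), generation 161.
Index `t4/b2b-balaban-t4-ne7b-p1/g161/INDEX.md`; memo `g161/records/SCOPING-G3.md`.  Over ✓ `NE7DiagonalGaugeCurve` (the diagonal gauge curve `s ↦` coordinates of `(chart_U(sX))^{e^{sY}}`:
`Φ(0) = 0`, `Φ′(0) = X + ξ_Y`, `𝒜` and `𝒢` invariant along it; the abstract second-order invariance at a Lagrangian-critical point) and the multiplier identity of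
✓ `NE7MinActC2AllDataUniform.multiplier_eq_fderiv_minAct_allData_uniform` (`w·D𝒜(0) = Dm(0) ∘ levelQ′`, `∃ δ_V ∀ j` by row NE7b's ✓ p830442).
WHAT ([folklore]; 0 def, 0 sorry):
* §3 `fderiv_levelQ_chart_subtype_apply` (`D(𝒢∘ι)(0)[Z] = levelQ′ Z` on `skewSub`); **`borderedForm_add_gaugeDir`** (every `d`, every `U(n)`, `L ≥ 1`; base `U` in row NE3-R2's multi-level class
  WITH ROOM): for ANY `w : ℝ` and ANY continuous linear `Λ` with `w·D𝒜(0) = Λ ∘ D𝒢(0)`: (i) `levelQ′ L N j U ξ_Y = 0`, (ii) `B[X + ξ_Y, X + ξ_Y] = B[X, X]`.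
* §4 **`borderedHessian_add_gaugeDir_allData_uniform`** (`d = 4`, `L ≥ 2`): `∃ ε₀ > 0 ∀ 0 < ε ≤ ε₀ ∀ N ≥ 1 ∃ δ_V > 0 ∀ j ∀ V₀` (unitary, `N`-periodic, `δ_V`-small) `∀ U♯` minimiser
  `∀ X ∈ skewSub M ∀ Y` (`𝔲(n)`-valued, `M`-periodic, `Y(L^{j+1}·z) = 0`): (i) and (ii) with `w = stepWt⁻ʲ⁻¹`, `Λ = D(minAct_{j+1} ∘ chart_{V₀})(0)` — verbatim the terms of
  ✓ `NE7MinActHessianLagrangianAllData.minAct_hessian_lagrangian_allData` (class smallness with room at `2ε` from ✓ `thresholds`).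
HONEST FRAMING (page 1): symmetry identities over landed kernel theorems; radii existential as in the road's files; OUR minimisers (B11 (8) with `sfClass`); nothing of Bałaban's asserted;
NOT (G), NOT NE7 as a spine node, NOT NE3; row NE7b NOT PRINTED ∕ NOT PROVED; spine 0∕9; finite T⁴ rung (B)+1 — NOT infinite volume, NOT mass gap, NOT BetaPertH, NOT Clay.
-/

set_option autoImplicit false

open scoped BigOperators Matrix Matrix.Norms.L2Operator Topology
open NormedSpace Finset Set Filter Metric

namespace Summit.QuantumFields.BalabanUV.T4Continuum.NE7BorderedHessianGaugeDegenerate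

open Literature.MathematicalPhysics.QuantumFieldTheory.Balaban1983to89
open B7Prop1Explicit B7Prop2Explicit MatrixLog UnitaryModel
open T4AveragingDeficitWall (IsUnitaryCfg SmallField fineAction hasDerivAt_exp_smul_zero hasDerivAt_exp_neg_smul_zero)
open T4AveragingDeficitWallBoundary (IsPeriodicCfg)
open AveragingDeficitTorusChart (TDir chart chartDir chart_zero chart_smul resDir redN_boxVec isUnitaryCfg_chart isPeriodicCfg_chart)
open AveragingDeficitChartCalculus (relLog relLog_self hasFDerivAt_mlog_one contDiffAt_val_chart contDiffAt_fineAction_chart)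
open AveragingDeficitFermat (eventually_smallField_chart)
open AveragingDeficitTwoLevelPrep (skewSub skewPR skewPF skewPF_of_mem)
open AveragingDeficitMultiLevelPrep (tower cavgIter levelQ levelQ' LevelSmall)
open MinimalActionLevels (perWin stepWt)
open MinimalActionSandwich (IsMinimiser minAct)
open MinimalActionRate (sfClass)
open NE3EnergyShapes (IsUnitarySite IsPeriodicSite)
open NE3EnergyAssembly (fineAction_gaugeAct)
open NE3ResidualSliceRep (cavgIter_gaugeAct_of_cornerTrivial)
open NE7AdmissibleFibreLHC (chart_id_eq_chart_skewP period_succ_eq)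
open NE7TorusChartDecoding (chart_skewPR_relLog_eq)
open NE7FibreStraightening (contDiffAt_levelQ)
open NE7SecondOrderChainRuleVec (fderiv_fderiv_comp_vec fderiv_fderiv_comp_clm_vec)
open NE7ConstraintSecondDerivativeRecursion (fderiv_levelQ_chart)
open NE7MultiplierAnnihilatesGaugeDirections (expGauge_isUnitarySite)
open NE7MinimalOrbitDatumContinuity (thresholds)
open NE7MinActC2AllDataUniform (multiplier_eq_fderiv_minAct_allData_uniform)
open BlockAveragePushDirGauge (gaugeDir expGauge expGauge_zero gaugeAct_const_one isPeriodicCfg_gaugeAct_expGauge)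
open AveragingDeficitKDatum (isUnitaryCfg_gaugeAct)

noncomputable section

variable {d : ℕ} {n : Type} [Fintype n] [DecidableEq n]

open NE7DiagonalGaugeCurve

/-! ## §3 The bordered form is blind to corner-trivial gauge directions -/

section Bordered

variable [Nonempty n]

/-- The derivative of the constraint map restricted to `skewSub`: `D(levelQ L N j U ∘ chart_U ∘ ι)(0)[Z] = levelQ′ L N j U Z`. [folklore] -/
theorem fderiv_levelQ_chart_subtype_apply {L N : ℕ} [NeZero L] [NeZero N] (hL : 1 ≤ L) (j : ℕ)
    {U : Site d → Fin d → (Matrix n n ℂ)ˣ} {x : ℝ} (hU : IsUnitaryCfg U) (hUP : IsPeriodicCfg U ((L : ℤ) * (tower L N j : ℕ)))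
    (hx : 0 ≤ x) (hs : LevelSmall d L j x) (hUx : SmallField U x) (Z : ↥(skewSub d n (L * tower L N j))) :
    fderiv ℝ (fun Φ : ↥(skewSub d n (L * tower L N j)) =>
        levelQ L N j U (chart (ContinuousLinearMap.id ℝ (Matrix n n ℂ)) (L * tower L N j) U (Φ : TDir d n (L * tower L N j)))) 0 Z
      = levelQ' L N j U (Z : TDir d n (L * tower L N j)) := by
  have h := (AveragingDeficitMultiLevelFermat.hasStrictFDerivAt_levelQ (M' := N) hL j hU hUP hx hs hUx).hasFDerivAt
  have h0 : ((skewSub d n (L * tower L N j)).subtypeL (0 : ↥(skewSub d n (L * tower L N j))) : TDir d n (L * tower L N j)) = 0 := by simp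
  rw [← h0] at h
  have hc := h.comp (0 : ↥(skewSub d n (L * tower L N j))) (skewSub d n (L * tower L N j)).subtypeL.hasFDerivAt
  rw [show (fun Φ : ↥(skewSub d n (L * tower L N j)) =>
        levelQ L N j U (chart (ContinuousLinearMap.id ℝ (Matrix n n ℂ)) (L * tower L N j) U (Φ : TDir d n (L * tower L N j))))
      = (fun Φ : TDir d n (L * tower L N j) => levelQ L N j U (chart (ContinuousLinearMap.id ℝ (Matrix n n ℂ)) (L * tower L N j) U Φ))
          ∘ (skewSub d n (L * tower L N j)).subtypeL from rfl, hc.fderiv]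
  rfl

/-- **THE BORDERED FORM IS BLIND TO CORNER-TRIVIAL GAUGE DIRECTIONS.**  Base `U` unitary, `(L·tower L N j)`-periodic, in row NE3-R2's multi-level class WITH ROOM (`SmallField U x`,
`x < x′`, `LevelSmall d L j x′`); `Y` a `𝔲(n)`-valued `(L·tower L N j)`-periodic site field with `Y(L^{j+1}·z) = 0`; `ξ_Y := skewPR (res (gaugeDir U Y))`.  For ANY `w : ℝ` and ANY
continuous linear `Λ` on `skewSub N` satisfying the multiplier identity `w·D𝒜(0)[Z] = Λ(D𝒢(0)[Z])` (`𝒜 = fineAction(·)(Wn) ∘ chart_U`, `𝒢 = levelQ L N j U ∘ chart_U` on `skewSub M`):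
(i) `levelQ′ L N j U ξ_Y = 0`; (ii) `w·D²𝒜(0)[X+ξ_Y, X+ξ_Y] − Λ(D²𝒢(0)[X+ξ_Y, X+ξ_Y]) = w·D²𝒜(0)[X,X] − Λ(D²𝒢(0)[X,X])` for every `X ∈ skewSub M`. [folklore] -/
theorem borderedForm_add_gaugeDir {L N : ℕ} [NeZero L] [NeZero N] (hL : 1 ≤ L) (j : ℕ)
    {U : Site d → Fin d → (Matrix n n ℂ)ˣ} {x x' : ℝ} (hU : IsUnitaryCfg U) (hUP : IsPeriodicCfg U ((L * tower L N j : ℕ) : ℤ))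
    (hx : 0 ≤ x) (hxx' : x < x') (hs' : LevelSmall d L j x') (hUx : SmallField U x)
    {Y : Site d → Matrix n n ℂ} (hY : ∀ x, Y x ∈ skewAdjoint (Matrix n n ℂ))
    (hYP : ∀ (z : Site d) (i : Fin d), Y (z + ((L * tower L N j : ℕ) : ℤ) • e i) = Y z) (hYc : ∀ z : Site d, Y (((L : ℤ) ^ (j + 1)) • z) = 0)
    (Wn : Finset (T4AveragingDeficitWall.Plaq d)) (w : ℝ) (Λ : ↥(skewSub d n N) →L[ℝ] ℝ)
    (hcrit : ∀ Z : ↥(skewSub d n (L * tower L N j)),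
      w * fderiv ℝ (fun Φ : ↥(skewSub d n (L * tower L N j)) =>
          fineAction (chart (ContinuousLinearMap.id ℝ (Matrix n n ℂ)) (L * tower L N j) U (Φ : TDir d n (L * tower L N j))) Wn) 0 Z
        = Λ (fderiv ℝ (fun Φ : ↥(skewSub d n (L * tower L N j)) =>
          levelQ L N j U (chart (ContinuousLinearMap.id ℝ (Matrix n n ℂ)) (L * tower L N j) U (Φ : TDir d n (L * tower L N j)))) 0 Z))
    (X : ↥(skewSub d n (L * tower L N j))) :
    levelQ' L N j U ((skewPR (d := d) (n := n) (L * tower L N j) (resDir (L * tower L N j) (gaugeDir U Y)) : ↥(skewSub d n (L * tower L N j))) :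
        TDir d n (L * tower L N j)) = 0 ∧
    w * fderiv ℝ (fderiv ℝ (fun Φ : ↥(skewSub d n (L * tower L N j)) =>
          fineAction (chart (ContinuousLinearMap.id ℝ (Matrix n n ℂ)) (L * tower L N j) U (Φ : TDir d n (L * tower L N j))) Wn)) 0
          (X + skewPR (d := d) (n := n) (L * tower L N j) (resDir (L * tower L N j) (gaugeDir U Y)))
          (X + skewPR (d := d) (n := n) (L * tower L N j) (resDir (L * tower L N j) (gaugeDir U Y)))
      - Λ (fderiv ℝ (fderiv ℝ (fun Φ : ↥(skewSub d n (L * tower L N j)) =>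
          levelQ L N j U (chart (ContinuousLinearMap.id ℝ (Matrix n n ℂ)) (L * tower L N j) U (Φ : TDir d n (L * tower L N j))))) 0
          (X + skewPR (d := d) (n := n) (L * tower L N j) (resDir (L * tower L N j) (gaugeDir U Y)))
          (X + skewPR (d := d) (n := n) (L * tower L N j) (resDir (L * tower L N j) (gaugeDir U Y))))
    = w * fderiv ℝ (fderiv ℝ (fun Φ : ↥(skewSub d n (L * tower L N j)) =>
          fineAction (chart (ContinuousLinearMap.id ℝ (Matrix n n ℂ)) (L * tower L N j) U (Φ : TDir d n (L * tower L N j))) Wn)) 0 X X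
      - Λ (fderiv ℝ (fderiv ℝ (fun Φ : ↥(skewSub d n (L * tower L N j)) =>
          levelQ L N j U (chart (ContinuousLinearMap.id ℝ (Matrix n n ℂ)) (L * tower L N j) U (Φ : TDir d n (L * tower L N j))))) 0 X X) := by
  have hUP' : IsPeriodicCfg U ((L : ℤ) * (tower L N j : ℕ)) := by
    have e : ((L * tower L N j : ℕ) : ℤ) = (L : ℤ) * (tower L N j : ℕ) := by push_cast; ring
    rw [← e]; exact hUP
  have hsU : LevelSmall d L j x := hs'.mono hx hxx'.le
  -- the two functionals are `C²` at `0`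
  have h𝒜 : ContDiffAt ℝ 2 (fun Φ : ↥(skewSub d n (L * tower L N j)) =>
      fineAction (chart (ContinuousLinearMap.id ℝ (Matrix n n ℂ)) (L * tower L N j) U (Φ : TDir d n (L * tower L N j))) Wn) 0 := by
    have hf : ContDiffAt ℝ 2 (fun ψ : TDir d n (L * tower L N j) => fineAction (chart (ContinuousLinearMap.id ℝ (Matrix n n ℂ)) (L * tower L N j) U ψ) Wn)
        ((skewSub d n (L * tower L N j)).subtypeL (0 : ↥(skewSub d n (L * tower L N j)))) := by
      rw [map_zero]; exact contDiffAt_fineAction_chart (m := 2) _ (L * tower L N j) U Wn 0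
    exact hf.comp (0 : ↥(skewSub d n (L * tower L N j))) (skewSub d n (L * tower L N j)).subtypeL.contDiff.contDiffAt
  have h𝒢 : ContDiffAt ℝ 2 (fun Φ : ↥(skewSub d n (L * tower L N j)) =>
      levelQ L N j U (chart (ContinuousLinearMap.id ℝ (Matrix n n ℂ)) (L * tower L N j) U (Φ : TDir d n (L * tower L N j)))) 0 := by
    have hf : ContDiffAt ℝ 2 (fun ψ : TDir d n (L * tower L N j) => levelQ L N j U (chart (ContinuousLinearMap.id ℝ (Matrix n n ℂ)) (L * tower L N j) U ψ))
        ((skewSub d n (L * tower L N j)).subtypeL (0 : ↥(skewSub d n (L * tower L N j)))) := by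
      rw [map_zero]; exact contDiffAt_levelQ (m := 2) (M' := N) hL j hU hUP' hx hsU hUx
    exact hf.comp (0 : ↥(skewSub d n (L * tower L N j))) (skewSub d n (L * tower L N j)).subtypeL.contDiff.contDiffAt
  -- the diagonal gauge curve
  have hΦ := contDiffAt_gaugeCurve (m := 2) U X Y
  have hΦ0 := gaugeCurve_zero U X Y
  have hW := fderiv_gaugeCurve_one U X Y
  have hA : (fun s : ℝ => (fun Φ : ↥(skewSub d n (L * tower L N j)) =>
        fineAction (chart (ContinuousLinearMap.id ℝ (Matrix n n ℂ)) (L * tower L N j) U (Φ : TDir d n (L * tower L N j))) Wn)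
      (skewPR (d := d) (n := n) (L * tower L N j) (relLog (L * tower L N j) U (gaugeAct (expGauge Y s) (chart (ContinuousLinearMap.id ℝ (Matrix n n ℂ)) (L * tower L N j) U (s • (X : TDir d n (L * tower L N j))))))))
      =ᶠ[𝓝 0] fun s : ℝ => (fun Φ : ↥(skewSub d n (L * tower L N j)) =>
        fineAction (chart (ContinuousLinearMap.id ℝ (Matrix n n ℂ)) (L * tower L N j) U (Φ : TDir d n (L * tower L N j))) Wn) (s • X) := by
    refine (eventually_fineAction_gaugeCurve hU hUP X hY hYP Wn).mono fun s hs => ?_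
    simp only [Submodule.coe_smul]
    exact hs
  have hG : (fun s : ℝ => (fun Φ : ↥(skewSub d n (L * tower L N j)) =>
        levelQ L N j U (chart (ContinuousLinearMap.id ℝ (Matrix n n ℂ)) (L * tower L N j) U (Φ : TDir d n (L * tower L N j))))
      (skewPR (d := d) (n := n) (L * tower L N j) (relLog (L * tower L N j) U (gaugeAct (expGauge Y s) (chart (ContinuousLinearMap.id ℝ (Matrix n n ℂ)) (L * tower L N j) U (s • (X : TDir d n (L * tower L N j))))))))
      =ᶠ[𝓝 0] fun s : ℝ => (fun Φ : ↥(skewSub d n (L * tower L N j)) =>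
        levelQ L N j U (chart (ContinuousLinearMap.id ℝ (Matrix n n ℂ)) (L * tower L N j) U (Φ : TDir d n (L * tower L N j)))) (s • X) := by
    refine (eventually_levelQ_gaugeCurve hL j hU hUP hx hxx' hs' hUx X hY hYP hYc).mono fun s hs => ?_
    simp only [Submodule.coe_smul]
    exact hs
  refine ⟨?_, ?_⟩
  · -- (i) first order: `D𝒢(0)[X + ξ] = D𝒢(0)[X]`
    have h1 := first_order_invariance (X := X) h𝒢 hΦ hΦ0 hG
    rw [hW, map_add, add_eq_left, fderiv_levelQ_chart_subtype_apply hL j hU hUP' hx hsU hUx] at h1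
    exact h1
  · -- (ii) second order
    have h2 := second_order_invariance (X := X) h𝒜 h𝒢 hΦ hΦ0 hcrit hA hG
    rw [hW] at h2
    exact h2

end Bordered

/-! ## §4 At the minimisers of the road: `d = 4`, every `U(n)`, `L ≥ 2` -/

/-- **THE BORDERED HESSIAN OF THE CONSTRAINED MINIMAL ACTION IS DEGENERATE ALONG THE FINE STABILISER ORBIT** (`d = 4`, every `U(n)`, `L ≥ 2`): `∃ ε₀ > 0 ∀ 0 < ε ≤ ε₀ ∀ N ≥ 1
∃ δ_V > 0 ∀ j`, for every unitary `N`-periodic `δ_V`-small datum `V₀`, every minimiser `U♯` of the `(j+1)`-fold constrained problem over `V₀`, every `X ∈ skewSub M` (`M = L·tower L N j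
= N·L^{j+1}`) and every `𝔲(n)`-valued `M`-periodic site field `Y` with `Y(L^{j+1}·z) = 0`, with `ξ_Y = skewPR (res (gaugeDir U♯ Y))`, `𝒜 = fineAction(·)(perWin) ∘ chart_{U♯}`,
`𝒢 = levelQ L N j U♯ ∘ chart_{U♯}`, `m = minAct_{j+1} ∘ chart_{V₀}`, `w = stepWt⁻ʲ⁻¹`:  `levelQ′ L N j U♯ ξ_Y = 0` and
`w·D²𝒜(0)[X+ξ_Y, X+ξ_Y] − Dm(0)[D²𝒢(0)[X+ξ_Y, X+ξ_Y]] = w·D²𝒜(0)[X,X] − Dm(0)[D²𝒢(0)[X,X]]` — verbatim the quantity minimised in ✓ p828683.  (✓ `thresholds` for the class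
smallness with room at `2ε`; ✓ `multiplier_eq_fderiv_minAct_allData_uniform` for the multiplier identity.) [folklore] -/
theorem borderedHessian_add_gaugeDir_allData_uniform [Nonempty n] {L : ℕ} [NeZero L] (hL : 2 ≤ L) :
    ∃ ε₀ : ℝ, 0 < ε₀ ∧ ∀ ε : ℝ, 0 < ε → ε ≤ ε₀ → ∀ (N : ℕ) [NeZero N], 1 ≤ N → ∃ δV : ℝ, 0 < δV ∧ ∀ j : ℕ,
        ∀ V₀ ∈ {V : Site 4 → Fin 4 → (Matrix n n ℂ)ˣ | IsUnitaryCfg V ∧ IsPeriodicCfg V (N : ℤ) ∧ SmallField V δV},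
        ∀ Us : Site 4 → Fin 4 → (Matrix n n ℂ)ˣ, IsMinimiser 4 (sfClass 4 L N ε) L N (j + 1) V₀ Us →
        ∀ (X : ↥(skewSub 4 n (L * tower L N j))) (Y : Site 4 → Matrix n n ℂ), (∀ z, Y z ∈ skewAdjoint (Matrix n n ℂ)) →
          (∀ (z : Site 4) (i : Fin 4), Y (z + ((L * tower L N j : ℕ) : ℤ) • e i) = Y z) → (∀ z : Site 4, Y (((L : ℤ) ^ (j + 1)) • z) = 0) →
        levelQ' L N j Us ((skewPR (d := 4) (n := n) (L * tower L N j) (resDir (L * tower L N j) (gaugeDir Us Y)) : ↥(skewSub 4 n (L * tower L N j))) :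
            TDir 4 n (L * tower L N j)) = 0 ∧
        ((stepWt 4 L)⁻¹) ^ (j + 1) * fderiv ℝ (fderiv ℝ (fun Φ : ↥(skewSub 4 n (L * tower L N j)) =>
              fineAction (chart (ContinuousLinearMap.id ℝ (Matrix n n ℂ)) (L * tower L N j) Us (Φ : TDir 4 n (L * tower L N j))) (perWin 4 (N * L ^ (j + 1))))) 0
              (X + skewPR (d := 4) (n := n) (L * tower L N j) (resDir (L * tower L N j) (gaugeDir Us Y)))
              (X + skewPR (d := 4) (n := n) (L * tower L N j) (resDir (L * tower L N j) (gaugeDir Us Y)))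
          - fderiv ℝ (fun y : ↥(skewSub 4 n N) => minAct 4 (sfClass 4 L N ε) L N (j + 1) (chart (ContinuousLinearMap.id ℝ (Matrix n n ℂ)) N V₀ (y : TDir 4 n N))) 0
              (fderiv ℝ (fderiv ℝ (fun Φ : ↥(skewSub 4 n (L * tower L N j)) =>
                levelQ L N j Us (chart (ContinuousLinearMap.id ℝ (Matrix n n ℂ)) (L * tower L N j) Us (Φ : TDir 4 n (L * tower L N j))))) 0
                (X + skewPR (d := 4) (n := n) (L * tower L N j) (resDir (L * tower L N j) (gaugeDir Us Y)))
                (X + skewPR (d := 4) (n := n) (L * tower L N j) (resDir (L * tower L N j) (gaugeDir Us Y))))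
        = ((stepWt 4 L)⁻¹) ^ (j + 1) * fderiv ℝ (fderiv ℝ (fun Φ : ↥(skewSub 4 n (L * tower L N j)) =>
              fineAction (chart (ContinuousLinearMap.id ℝ (Matrix n n ℂ)) (L * tower L N j) Us (Φ : TDir 4 n (L * tower L N j))) (perWin 4 (N * L ^ (j + 1))))) 0 X X
          - fderiv ℝ (fun y : ↥(skewSub 4 n N) => minAct 4 (sfClass 4 L N ε) L N (j + 1) (chart (ContinuousLinearMap.id ℝ (Matrix n n ℂ)) N V₀ (y : TDir 4 n N))) 0
              (fderiv ℝ (fderiv ℝ (fun Φ : ↥(skewSub 4 n (L * tower L N j)) =>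
                levelQ L N j Us (chart (ContinuousLinearMap.id ℝ (Matrix n n ℂ)) (L * tower L N j) Us (Φ : TDir 4 n (L * tower L N j))))) 0 X X) := by
  obtain ⟨ε₁, hε₁, T⟩ := thresholds (n := n) hL
  obtain ⟨ε₂, hε₂, Mu⟩ := multiplier_eq_fderiv_minAct_allData_uniform (n := n) hL
  have hL1 : 1 ≤ L := le_trans (by norm_num) hL
  refine ⟨min (ε₁ / 2) ε₂, lt_min (by positivity) hε₂, fun ε hε hεle N _ hN => ?_⟩
  have h2ε : 2 * ε ≤ ε₁ := by have := hεle.trans (min_le_left _ _); linarith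
  obtain ⟨-, -, hls2, -⟩ := T (2 * ε) (by positivity) h2ε
  obtain ⟨δV, hδV, H⟩ := Mu ε hε (hεle.trans (min_le_right _ _)) N hN
  refine ⟨δV, hδV, fun j V₀ hV₀ Us hUs X Y hY hYP hYc => ?_⟩
  obtain ⟨-, hmult⟩ := H j V₀ hV₀ Us hUs
  -- the minimiser as a base of the multi-level class, with room
  obtain ⟨hUsu, hUsP, hUsx⟩ := hUs.mem.1
  have hUsP' : IsPeriodicCfg Us ((L * tower L N j : ℕ) : ℤ) := by rw [← period_succ_eq]; exact hUsP
  have hUsP'' : IsPeriodicCfg Us ((L : ℤ) * (tower L N j : ℕ)) := by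
    have e : ((L * tower L N j : ℕ) : ℤ) = (L : ℤ) * (tower L N j : ℕ) := by push_cast; ring
    rw [← e]; exact hUsP'
  have hx : 0 ≤ ε / ((L : ℝ) ^ (j + 1)) ^ 2 := by positivity
  have hxx' : ε / ((L : ℝ) ^ (j + 1)) ^ 2 < 2 * ε / ((L : ℝ) ^ (j + 1)) ^ 2 := by
    have hLp : (0 : ℝ) < ((L : ℝ) ^ (j + 1)) ^ 2 := by positivity
    exact div_lt_div_of_pos_right (by linarith) hLp
  have hs' : LevelSmall 4 L j (2 * ε / ((L : ℝ) ^ (j + 1)) ^ 2) := hls2 j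
  have hsU : LevelSmall 4 L j (ε / ((L : ℝ) ^ (j + 1)) ^ 2) := hs'.mono hx hxx'.le
  -- the multiplier identity in the shape of §3
  have hcrit : ∀ Z : ↥(skewSub 4 n (L * tower L N j)),
      ((stepWt 4 L)⁻¹) ^ (j + 1) * fderiv ℝ (fun Φ : ↥(skewSub 4 n (L * tower L N j)) =>
          fineAction (chart (ContinuousLinearMap.id ℝ (Matrix n n ℂ)) (L * tower L N j) Us (Φ : TDir 4 n (L * tower L N j))) (perWin 4 (N * L ^ (j + 1)))) 0 Z
        = (fderiv ℝ (fun y : ↥(skewSub 4 n N) => minAct 4 (sfClass 4 L N ε) L N (j + 1) (chart (ContinuousLinearMap.id ℝ (Matrix n n ℂ)) N V₀ (y : TDir 4 n N))) 0)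
          (fderiv ℝ (fun Φ : ↥(skewSub 4 n (L * tower L N j)) =>
            levelQ L N j Us (chart (ContinuousLinearMap.id ℝ (Matrix n n ℂ)) (L * tower L N j) Us (Φ : TDir 4 n (L * tower L N j)))) 0 Z) := by
    intro Z
    rw [fderiv_levelQ_chart_subtype_apply hL1 j hUsu hUsP'' hx hsU hUsx Z]
    exact hmult Z
  exact borderedForm_add_gaugeDir hL1 j hUsu hUsP' hx hxx' hs' hUsx hY hYP hYc (perWin 4 (N * L ^ (j + 1)))
    (((stepWt 4 L)⁻¹) ^ (j + 1)) _ hcrit X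

end

end Summit.QuantumFields.BalabanUV.T4Continuum.NE7BorderedHessianGaugeDegenerate
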